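/-
Copyright (c) 2026 the pub-hodgecm-mathlib formalisation cell (harness21).  Prover seat hodgecm-mathlib-F0P2-p06 (g11), 2026-09-01.  Road «S3-tree» (architect A-p16 (g30)),
brick T3′ «depth-zero κ-transfer», P-2 row (R2²) «THE FREE ROW, TYPE (2)» (holder A-p19 (g26)), head [T2-d] sub-organ (D2) «THE EIGEN-FIELD PACKAGE AT w», part α:
the CM ∕ inert-place inputs — the skew square root of the discriminant and the two norm facts about `σ_w`.
-/
import Literature.NumberTheory.LocalFields.UnramifiedQuadraticFixedSquares          -- ★ `isSquare_coe_of_isUnit_of_isSquare_residue`; brings ★ inert unit norms, Frobenius residue, CM uniformiser kit, Valued∕ValuativeRel bridge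
import Literature.NumberTheory.Automorphic.UnitaryGroupInertPlaceHyperbolicBasis      -- ★ `exists_toPlace_eq_of_galAdicCompletionMap_eq`, `galAdicCompletionMap_galAdicCompletionMap_of_smul_eq`
import Literature.NumberTheory.NumberFields.QuadraticCompletionIntegralBasis          -- ★ Q5: `ramificationIdx'_eq_one_of_isUnramifiedIn`, `valued_toPlace_of_ramificationIdx'_eq_one`
import HarnessLib

/-!
# T3′ P-2 row (R2²), organ (D2-α): at an inert place `w ∣ v` of a CM field, `disc χ_g = y² · ι_w k₀` with `k₀` a uniformiser of `L⁺_v` and `σ_w y = −y · σ_w D`;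
# `σ_w` moves an integer by a unit; `σ_w`-fixed elements of even order are norms

Topic `NumberTheory/LocalFields`; namespace `Literature.NumberTheory.LocalFields`.  THEOREMS ONLY (no definition, no instance, no notation, no named fact, no `sorry`); kernel lane
`--supports stmt-HodgeConjecture-24833`.  Cell `pub/hodgecm-mathlib` (D-0151), crux H413; road «S3-tree», brick T3′, P-2 row (R2²) (holder A-p19 (g26), head [T2-d]; architect A-p16 (g30)
A-145∕A-152), sub-organ **(D2) «THE EIGEN-FIELD PACKAGE AT w»**, part α = the CM inputs of part β `Rogawski1990/TypeTwoEigenFieldPackage` (p846663): `hmove`, `hnormF`, and the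
datum `(y, k₀)` with `4D = t² − y²·ι k₀`, `σ y = −(y·σD)`.  HONEST LABEL: HC_CM is proved only modulo the 2 remaining named inputs (hLiu418 24832, h413 24833) until rung 0 closes;
unconditional local algebra, count-neutral.

THE SETTING.  `L` a CM field, `L⁺` its maximal real subfield, `v` a finite place of `L⁺` UNRAMIFIED in `L` with `v ∤ 2`, `w ∣ v` the place of `L` (`c • w = w`, `c` = complex conjugation),
`σ := σ_w = galAdicCompletionMap c hw : L_w →+* L_w`, `ι := toPlace v w : L⁺_v →+* L_w`, `ϖ := ι(ϖ_v)` the `σ`-fixed uniformiser.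
* §0 (generic non-archimedean local field with Frobenius reduction of order `q²`, `2 ∈ 𝒪ˣ`): **`isSquare_of_frobenius_mul_eq_one`** (`ȳ·ȳ^q = 1 ⇒ ȳ` a square: `ȳ^{q²∕2} =
  (ȳ^{q+1})^{(q−1)∕2}`), **`isSquare_coe_of_isUnit_of_mul_map_eq_one`** (a NORM-ONE unit `u·σu = 1` is a square, by Hensel ★ `isSquare_coe_of_isUnit_of_isSquare_residue`).
* §1 **`exists_isUnit_galAdicCompletionMap_sub`** (`hmove`: a unit `a ∈ 𝒪[L_w]` moved by a unit — `σ̄ = Frob_q ≠ id`, ★ `exists_isUnit_map_sub_of_residueHom_ne`);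
  **`exists_mul_galAdicCompletionMap_mul_eq_one_of_even`** (`hnormF`: a `σ`-fixed `c ≠ 0` of EVEN order has `a·σa·c = 1` — `c·ϖ^{log|c|}` is a `σ`-fixed unit, a norm by ★
  `exists_mul_galAdicCompletionMap_eq_of_inert`); `isSquare_of_mul_galAdicCompletionMap_eq_one` (a norm-one unit of `L_w` is a square); `exists_skew_unit` (`σ u₁ = −u₁`, `|u₁| = 1`, `u₁² ∈ ι(L⁺_v)`).
* §2 **`exists_skew_sqrt_discriminant`**: for `t, D ∈ L_w` with `D·σD = 1`, `σt = t·σD` and `|t² − 4D|_w = exp(−(2N+1))`: `∃ y ∈ L_w, k₀ ∈ L⁺_v` with `|k₀|_v = exp(−1)`,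
  `4D = t² − y²·ι k₀`, `σ y = −(y·σD)`, `|y|_w = exp(−N)`.  Route: `D = r²` (§0); `Δ₀ := (t² − 4D)·σD` is `σ`-fixed, `= ι a` (★ `exists_toPlace_eq_of_galAdicCompletionMap_eq`), `|a|_v = exp(−(2N+1))`,
  `k₀ := a ∕ ϖ_v^{2N}`, `y₀ := ϖ^N·r`; `r·σr = ±1` gives `σ y₀ = ∓ y₀·σD`; in the `+` case twist `y₀` by the skew unit `u₁` and `k₀` by `u₁² = ι f₁`.

## References
* [SerreLocalFields1979] J.-P. Serre, *Local Fields*, GTM 67 (1979): Ch. V §2 Prop. 3 and Corollary; Ch. XIV §4 (Euler ∕ Hensel for squares).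
* [Neukirch1999] J. Neukirch, *Algebraic Number Theory*, Grundlehren 322 (1999): Ch. II (4.3), (5.7)–(5.8), §7.
* [Rogawski1990] J. D. Rogawski, *Automorphic Representations of Unitary Groups in Three Variables* (1990): §4.9 Lemma 4.9.3 p. 56 (the type-(2) torus `E¹ × K₁¹`).
-/

set_option autoImplicit false

noncomputable section

open NumberField IsDedekindDomain ValuativeRel
open scoped ValuativeRel
open Literature.NumberTheory.Automorphic Literature.NumberTheory.Automorphic.UnitaryGroup Literature.NumberTheory.GaloisRepresentations
open Literature.NumberTheory.LocalFields.UnramifiedQuadraticNorm Literature.NumberTheory.NumberFields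

namespace Literature.NumberTheory.LocalFields

/-! ## §0 A non-archimedean local field with Frobenius reduction: norm-one units are squares -/

section LocalField

variable {E : Type*} [Field E] [ValuativeRel E] [TopologicalSpace E] [IsNonarchimedeanLocalField E] (σ : E →+* E)

/-- **A residue of norm one is a square**: in a field of order `q²` and odd characteristic with `σk = (·)^q`, `y · σk y = 1` (i.e. `y^{q+1} = 1`) forces `y` to be a square —
`y^{q²∕2} = (y^{q+1})^{(q−1)∕2} = 1` (Euler's criterion, `q` odd). [cite: SerreLocalFields1979, Ch. V §2] [cite: Neukirch1999, Ch. II (4.3)] -/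
theorem isSquare_of_frobenius_mul_eq_one (σk : 𝓀[E] →+* 𝓀[E]) {q : ℕ} (hk : Nat.card 𝓀[E] = q ^ 2) (hσq : ∀ x : 𝓀[E], σk x = x ^ q)
    (h2 : (2 : 𝓀[E]) ≠ 0) {y : 𝓀[E]} (hy : y * σk y = 1) : IsSquare y := by
  classical
  letI : Fintype 𝓀[E] := Fintype.ofFinite _
  have hk' : Fintype.card 𝓀[E] = q ^ 2 := by rw [← Nat.card_eq_fintype_card, hk]
  have hy0 : y ≠ 0 := fun h0 => by rw [h0, zero_mul] at hy; exact zero_ne_one hy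
  have hchar : ringChar 𝓀[E] ≠ 2 := by
    intro h
    apply h2
    have h22 : ((2 : ℕ) : 𝓀[E]) = 0 := (ringChar.spec 𝓀[E] 2).2 (by rw [h])
    exact_mod_cast h22
  -- `q` is odd
  have hodd : q ^ 2 % 2 = 1 := by
    rw [← hk']
    rcases Nat.mod_two_eq_zero_or_one (Fintype.card 𝓀[E]) with h | h
    · exact absurd (FiniteField.even_card_iff_char_two.2 h) hchar
    · exact h
  have hq : q % 2 = 1 := by
    rcases Nat.mod_two_eq_zero_or_one q with h | h
    · exfalso; rw [Nat.pow_mod, h] at hodd; norm_num at hodd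
    · exact h
  -- `y^{q+1} = 1`
  have hyq : y ^ (q + 1) = 1 := by rw [pow_succ', ← hσq y]; exact hy
  rw [FiniteField.isSquare_iff hchar hy0, hk']
  have hdiv : q ^ 2 / 2 = (q + 1) * ((q - 1) / 2) := by
    obtain ⟨m, rfl⟩ : ∃ m, q = 2 * m + 1 := ⟨q / 2, by omega⟩
    have e1 : (2 * m + 1) ^ 2 / 2 = 2 * m * m + 2 * m := by
      rw [show (2 * m + 1) ^ 2 = (2 * m * m + 2 * m) * 2 + 1 by ring]; omega
    have e2 : (2 * m + 1 - 1) / 2 = m := by omega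
    rw [e1, e2]; ring
  rw [hdiv, pow_mul, hyq, one_pow]

/-- **A NORM-ONE UNIT IS A SQUARE** when `σ` reduces to the `q`-Frobenius of a residue field of order `q²` and `|2| = 1` (the inert quadratic situation): for `u ∈ 𝒪ˣ` with
`u · σu = 1` the residue has norm one, hence is a square (`isSquare_of_frobenius_mul_eq_one`), and Hensel lifts (★ `isSquare_coe_of_isUnit_of_isSquare_residue`).
[cite: SerreLocalFields1979, Ch. XIV §4] [cite: Neukirch1999, Ch. II (5.7)–(5.8)] -/
theorem isSquare_coe_of_isUnit_of_mul_map_eq_one (hσO : ∀ x : 𝒪[E], σ x ∈ 𝒪[E]) (σk : 𝓀[E] →+* 𝓀[E])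
    (hσk : ∀ x : 𝒪[E], IsLocalRing.residue 𝒪[E] ⟨σ x, hσO x⟩ = σk (IsLocalRing.residue 𝒪[E] x))
    {q : ℕ} (hk : Nat.card 𝓀[E] = q ^ 2) (hσq : ∀ x : 𝓀[E], σk x = x ^ q) (h2 : valuation E (2 : E) = 1)
    (u : 𝒪[E]) (hu : IsUnit u) (hσu : (u : E) * σ u = 1) : IsSquare (u : E) := by
  have h2O : IsUnit (2 : 𝒪[E]) := by
    rw [(Valuation.Integers.isUnit_iff_valuation_eq_one (Valuation.integer.integers (valuation E))), map_ofNat]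
    exact h2
  have h2k : (2 : 𝓀[E]) ≠ 0 := by
    have h := (IsLocalRing.residue_ne_zero_iff_isUnit (2 : 𝒪[E])).2 h2O
    rwa [map_ofNat] at h
  have hnorm : IsLocalRing.residue 𝒪[E] u * σk (IsLocalRing.residue 𝒪[E] u) = 1 := by
    rw [← hσk, ← map_mul, ← map_one (IsLocalRing.residue 𝒪[E])]
    congr 1
    exact Subtype.ext hσu
  exact isSquare_coe_of_isUnit_of_isSquare_residue h2 u hu (isSquare_of_frobenius_mul_eq_one σk hk hσq h2k hnorm)

end LocalField

/-! ## §1 The inert place of a CM field: `hmove`, `hnormF`, norm-one squares, a skew unit -/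

section CM

variable (L : Type) [Field L] [NumberField L] [IsCMField L] (v : HeightOneSpectrum (𝓞 ↥(maximalRealSubfield L)))
  (w : PlacesOver L v) (hw : IsCMField.complexConj L • w.1 = w.1) (hunr : Algebra.IsUnramifiedIn (𝓞 L) v.asIdeal)
  (h2 : Valued.v (2 : w.1.adicCompletion L) = 1)

include hunr in
/-- **`hmove` at an inert place**: some unit `a ∈ 𝒪[L_w]` has `σ_w a − a ∈ 𝒪[L_w]ˣ` (the reduction of `σ_w` is the `q`-Frobenius, which moves some residue of `𝔽_{q²}`, ★
`exists_frob_ne`; such an `a` is a unit since `𝔪_w` is `σ_w`-stable). [cite: SerreLocalFields1979, Ch. V §2 Prop. 3] -/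
theorem exists_isUnit_galAdicCompletionMap_sub :
    ∃ a : 𝒪[w.1.adicCompletion L], IsUnit a ∧
      galAdicCompletionMap (L := L) (IsCMField.complexConj L) hw a - a ∈ 𝒪[w.1.adicCompletion L] ∧
      ∃ b : 𝒪[w.1.adicCompletion L], (b : w.1.adicCompletion L) * (galAdicCompletionMap (L := L) (IsCMField.complexConj L) hw a - a) = 1 := by
  set σ := galAdicCompletionMap (L := L) (IsCMField.complexConj L) hw with hσdef
  have hc1 : IsCMField.complexConj L ≠ 1 := IsCMField.complexConj_ne_one L
  have hσO : ∀ x : 𝒪[w.1.adicCompletion L], σ x ∈ 𝒪[w.1.adicCompletion L] := mem_integer_galAdicCompletionMap (IsCMField.complexConj L) v w hw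
  obtain ⟨σk, hσk⟩ := exists_residueField_ringHom_galAdicCompletionMap (IsCMField.complexConj L) v w hw
  have hk := natCard_residueField_eq_sq_of_inert (IsCMField.complexConj L) v hc1 hunr w hw
  have hfrob := residueHom_galAdicCompletionMap_eq_pow (IsCMField.complexConj L) v hc1 hunr w hw σk hσO hσk
  letI : Fintype 𝓀[w.1.adicCompletion L] := Fintype.ofFinite _
  have hk' : Fintype.card 𝓀[w.1.adicCompletion L] = Nat.card (𝓞 ↥(maximalRealSubfield L) ⧸ v.asIdeal) ^ 2 := by
    rw [← Nat.card_eq_fintype_card, hk]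
  obtain ⟨ybar, hy⟩ := Literature.LinearAlgebra.Matrix.exists_frob_ne hk' σk hfrob
  obtain ⟨a, ha⟩ := exists_isUnit_map_sub_of_residueHom_ne σ hσO σk hσk ⟨ybar, hy⟩
  -- `a` is a unit: otherwise `a`, `σ a` and their difference lie in `𝔪`
  have hau : IsUnit a := by
    by_contra hna
    have hres : IsLocalRing.residue 𝒪[w.1.adicCompletion L] a = 0 := (IsLocalRing.residue_eq_zero_iff a).2 ((IsLocalRing.mem_maximalIdeal _).2 hna)
    have hres' : IsLocalRing.residue 𝒪[w.1.adicCompletion L] (⟨σ a, hσO a⟩ - a) = 0 := by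
      rw [map_sub, hσk, hres, map_zero, sub_zero]
    exact ((IsLocalRing.residue_ne_zero_iff_isUnit _).2 ha) hres'
  obtain ⟨u, hu⟩ := ha
  refine ⟨a, hau, ?_, ⟨((u⁻¹ : (𝒪[w.1.adicCompletion L])ˣ) : 𝒪[w.1.adicCompletion L]), ?_⟩⟩
  · have h := (⟨σ a, hσO a⟩ - a : 𝒪[w.1.adicCompletion L]).2
    exact h
  · have h1 : ((u⁻¹ : (𝒪[w.1.adicCompletion L])ˣ) : 𝒪[w.1.adicCompletion L]) * (⟨σ a, hσO a⟩ - a) = 1 := by rw [← hu, Units.inv_mul]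
    have h2' := congrArg (fun z : 𝒪[w.1.adicCompletion L] => (z : w.1.adicCompletion L)) h1
    simpa using h2'

include hunr in
/-- **`hnormF` at an inert place**: a `σ_w`-fixed `c ≠ 0` of even `w`-order satisfies `a · σ_w a · c = 1` for some `a ∈ L_w` — `c · ϖ^{log|c|}` is a `σ_w`-fixed UNIT (`ϖ = ι ϖ_v` is a
`σ_w`-fixed uniformiser), hence a norm `s₀ · σ_w s₀` (★ `exists_mul_galAdicCompletionMap_eq_of_inert`: `L_w ∕ L⁺_v` unramified), and `a := ϖ^{log|c|∕2} ∕ s₀`.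
[cite: SerreLocalFields1979, Ch. V §2 Prop. 3 and Corollary] [cite: Neukirch1999, Ch. II §7] -/
theorem exists_mul_galAdicCompletionMap_mul_eq_one_of_even (c : w.1.adicCompletion L) (hc0 : c ≠ 0)
    (hσc : galAdicCompletionMap (L := L) (IsCMField.complexConj L) hw c = c) (heven : Even (WithZero.log (Valued.v c))) :
    ∃ a : w.1.adicCompletion L, a * galAdicCompletionMap (L := L) (IsCMField.complexConj L) hw a * c = 1 := by
  set σ := galAdicCompletionMap (L := L) (IsCMField.complexConj L) hw with hσdef
  set ϖ : w.1.adicCompletion L := toPlace v w (HeckeCharacter.uniformizer ↥(maximalRealSubfield L) v : v.adicCompletion ↥(maximalRealSubfield L)) with hϖdef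
  have hc1 : IsCMField.complexConj L ≠ 1 := IsCMField.complexConj_ne_one L
  have hcc : IsCMField.complexConj L * IsCMField.complexConj L = 1 := Literature.NumberTheory.Automorphic.algEquiv_mul_self_eq_one (F := ↥(maximalRealSubfield L)) hc1
  have hϖ0 : ϖ ≠ 0 := toPlace_uniformizer_ne_zero L v w hunr
  have hσϖ : σ ϖ = ϖ := galAdicCompletionMap_toPlace_self L v w hw _
  obtain ⟨k, hk⟩ := heven
  have hvc0 : Valued.v c ≠ 0 := (Valuation.ne_zero_iff _).2 hc0
  -- the `σ`-fixed unit `c · ϖ^{k+k}`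
  have hu₀v : Valued.v (c * ϖ ^ (k + k)) = 1 := by
    rw [map_mul, valued_toPlace_uniformizer_zpow L v w hunr, ← WithZero.exp_log hvc0, hk, ← WithZero.exp_add, ← WithZero.exp_zero]
    congr 1; ring
  have hu₀ne : c * ϖ ^ (k + k) ≠ 0 := mul_ne_zero hc0 (zpow_ne_zero _ hϖ0)
  have hu₀O : c * ϖ ^ (k + k) ∈ 𝒪[w.1.adicCompletion L] := (v_le_one_iff_mem_integer _).1 hu₀v.le
  have hu₀u : IsUnit (⟨c * ϖ ^ (k + k), hu₀O⟩ : 𝒪[w.1.adicCompletion L]) := by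
    have hinvO : (c * ϖ ^ (k + k))⁻¹ ∈ 𝒪[w.1.adicCompletion L] := (v_le_one_iff_mem_integer _).1 (by rw [map_inv₀, hu₀v, inv_one])
    exact IsUnit.of_mul_eq_one ⟨_, hinvO⟩ (Subtype.ext (mul_inv_cancel₀ hu₀ne))
  have hσu₀ : σ ((⟨c * ϖ ^ (k + k), hu₀O⟩ : 𝒪[w.1.adicCompletion L]) : w.1.adicCompletion L) = (⟨c * ϖ ^ (k + k), hu₀O⟩ : 𝒪[w.1.adicCompletion L]) := by
    change σ (c * ϖ ^ (k + k)) = c * ϖ ^ (k + k)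
    rw [map_mul, map_zpow₀, hσc, hσϖ]
  obtain ⟨s₀, hs₀⟩ := exists_mul_galAdicCompletionMap_eq_of_inert (IsCMField.complexConj L) v hc1 hcc hunr w hw _ hu₀u hσu₀
  have hs₀' : (s₀ : w.1.adicCompletion L) * σ s₀ = c * ϖ ^ (k + k) := hs₀
  have hs₀0 : (s₀ : w.1.adicCompletion L) ≠ 0 := by
    intro h0; rw [h0, zero_mul] at hs₀'; exact hu₀ne hs₀'.symm
  have hσs₀0 : σ (s₀ : w.1.adicCompletion L) ≠ 0 := (map_ne_zero σ).2 hs₀0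
  refine ⟨ϖ ^ k * (s₀ : w.1.adicCompletion L)⁻¹, ?_⟩
  rw [map_mul, map_inv₀, map_zpow₀, hσϖ]
  field_simp
  rw [hs₀', zpow_add₀ hϖ0]
  ring

include hunr h2 in
/-- **A norm-one unit of `L_w` is a square** at an inert place with `v ∤ 2`: `D · σ_w D = 1 ⇒ D ∈ (L_w^×)²` (§0 at `σ_w`, whose reduction is the `q_v`-Frobenius of `𝔽_{q_v²}`).
[cite: SerreLocalFields1979, Ch. XIV §4] [cite: Neukirch1999, Ch. II (4.3), (5.7)] -/
theorem isSquare_of_mul_galAdicCompletionMap_eq_one {D : w.1.adicCompletion L}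
    (hσD : D * galAdicCompletionMap (L := L) (IsCMField.complexConj L) hw D = 1) : IsSquare D := by
  -- in `ℤᵐ⁰`, `x · x = 1 ⇒ x = 1` (the tree's ★ `WithZeroMulInt.eq_one_of_mul_self`, inlined to keep this file's imports local)
  have h11 : ∀ x : WithZero (Multiplicative ℤ), x * x = 1 → x = 1 := fun x h => by
    have hx0 : x ≠ 0 := fun h0 => by rw [h0, mul_zero] at h; exact zero_ne_one h
    have hlog := congrArg WithZero.log h
    rw [WithZero.log_mul hx0 hx0, WithZero.log_one] at hlog
    rw [← WithZero.exp_log hx0, ← WithZero.exp_zero]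
    congr 1
    omega
  set σ := galAdicCompletionMap (L := L) (IsCMField.complexConj L) hw with hσdef
  have hc1 : IsCMField.complexConj L ≠ 1 := IsCMField.complexConj_ne_one L
  have hσO : ∀ x : 𝒪[w.1.adicCompletion L], σ x ∈ 𝒪[w.1.adicCompletion L] := mem_integer_galAdicCompletionMap (IsCMField.complexConj L) v w hw
  -- `|D| = 1`
  have hD1 : Valued.v D = 1 := by
    have h := congrArg Valued.v hσD
    rw [map_mul, hσdef, valued_galAdicCompletionMap, map_one] at h
    exact h11 _ h
  have hDO : D ∈ 𝒪[w.1.adicCompletion L] := (v_le_one_iff_mem_integer _).1 hD1.le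
  have hD0 : D ≠ 0 := fun h0 => by rw [h0, map_zero] at hD1; exact zero_ne_one hD1
  have hDu : IsUnit (⟨D, hDO⟩ : 𝒪[w.1.adicCompletion L]) := by
    have hinvO : D⁻¹ ∈ 𝒪[w.1.adicCompletion L] := (v_le_one_iff_mem_integer _).1 (by rw [map_inv₀, hD1, inv_one])
    exact IsUnit.of_mul_eq_one ⟨_, hinvO⟩ (Subtype.ext (mul_inv_cancel₀ hD0))
  obtain ⟨σk, hσk⟩ := exists_residueField_ringHom_galAdicCompletionMap (IsCMField.complexConj L) v w hw
  have h2' : valuation (w.1.adicCompletion L) (2 : w.1.adicCompletion L) = 1 := (v_eq_one_iff_valuation_eq_one _).1 h2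
  exact isSquare_coe_of_isUnit_of_mul_map_eq_one σ hσO σk hσk (natCard_residueField_eq_sq_of_inert (IsCMField.complexConj L) v hc1 hunr w hw)
    (residueHom_galAdicCompletionMap_eq_pow (IsCMField.complexConj L) v hc1 hunr w hw σk hσO hσk) h2' ⟨D, hDO⟩ hDu hσD

include hunr in
/-- **A skew unit of `L_w`**: there is `u₁ ∈ L_w` with `σ_w u₁ = −u₁`, `|u₁|_w = 1` and `u₁² = ι f₁` for some `f₁ ∈ L⁺_v` (take the global `δ` with `c δ = −δ` and rescale by the `σ_w`-fixed
uniformiser `ϖ = ι ϖ_v` to valuation one; `u₁²` is `σ_w`-fixed, ★ `exists_toPlace_eq_of_galAdicCompletionMap_eq`). [cite: Neukirch1999, Ch. II §7] [cite: SerreLocalFields1979, Ch. V §2] -/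
theorem exists_skew_unit :
    ∃ (u₁ : w.1.adicCompletion L) (f₁ : v.adicCompletion ↥(maximalRealSubfield L)),
      galAdicCompletionMap (L := L) (IsCMField.complexConj L) hw u₁ = -u₁ ∧ Valued.v u₁ = 1 ∧ toPlace v w f₁ = u₁ * u₁ := by
  set σ := galAdicCompletionMap (L := L) (IsCMField.complexConj L) hw with hσdef
  set ϖ : w.1.adicCompletion L := toPlace v w (HeckeCharacter.uniformizer ↥(maximalRealSubfield L) v : v.adicCompletion ↥(maximalRealSubfield L)) with hϖdef
  have hc1 : IsCMField.complexConj L ≠ 1 := IsCMField.complexConj_ne_one L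
  have hϖ0 : ϖ ≠ 0 := toPlace_uniformizer_ne_zero L v w hunr
  have hσϖ : σ ϖ = ϖ := galAdicCompletionMap_toPlace_self L v w hw _
  -- the global skew element
  obtain ⟨τ, δ, hτδ, hδ⟩ := exists_algEquiv_apply_eq_neg (F := ↥(maximalRealSubfield L)) (E := L)
  have hτ1 : τ ≠ 1 := by
    rintro rfl
    rw [AlgEquiv.one_apply] at hτδ
    have h2δ : (2 : L) * δ = 0 := by linear_combination hτδ
    exact hδ ((mul_eq_zero.mp h2δ).resolve_left two_ne_zero)
  obtain rfl : τ = IsCMField.complexConj L := (Literature.NumberTheory.Automorphic.algEquiv_eq_one_or_eq (F := ↥(maximalRealSubfield L)) hc1 τ).resolve_left hτ1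
  set δK : w.1.adicCompletion L := ((δ : L) : w.1.adicCompletion L) with hδKdef
  have hcoe : ∀ x : L, (x : w.1.adicCompletion L) = algebraMap L (w.1.adicCompletion L) x := fun x => rfl
  have hσδK : σ δK = -δK := by
    rw [hδKdef, hσdef, galAdicCompletionMap_coe_algEquiv, hτδ, hcoe, hcoe, map_neg]
  have hδK0 : δK ≠ 0 := by
    rw [hδKdef, hcoe]; exact (map_ne_zero_iff _ (algebraMap L (w.1.adicCompletion L)).injective).2 hδ
  have hvδ0 : Valued.v δK ≠ 0 := (Valuation.ne_zero_iff _).2 hδK0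
  -- rescale to a unit
  set e₀ : ℤ := WithZero.log (Valued.v δK) with he₀
  refine ⟨δK * ϖ ^ e₀, ?_⟩
  have hσu : σ (δK * ϖ ^ e₀) = -(δK * ϖ ^ e₀) := by rw [map_mul, map_zpow₀, hσδK, hσϖ, neg_mul]
  have hvu : Valued.v (δK * ϖ ^ e₀) = 1 := by
    rw [map_mul, valued_toPlace_uniformizer_zpow L v w hunr, ← WithZero.exp_log hvδ0, ← he₀, ← WithZero.exp_add, add_neg_cancel, WithZero.exp_zero]
  -- `u₁²` is `σ`-fixed, hence in `ι(L⁺_v)`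
  have hfix : σ (δK * ϖ ^ e₀ * (δK * ϖ ^ e₀)) = δK * ϖ ^ e₀ * (δK * ϖ ^ e₀) := by rw [map_mul, hσu]; ring
  obtain ⟨f₁, hf₁⟩ := exists_toPlace_eq_of_galAdicCompletionMap_eq (IsCMField.complexConj L) w hc1 hw _ hfix
  exact ⟨f₁, hσu, hvu, hf₁⟩

/-! ## §2 The skew square root of the discriminant -/

include hunr h2 in
/-- **`disc χ_g = y² · ι_w k₀` WITH `k₀` A UNIFORMISER OF `L⁺_v` AND `σ_w y = −y · σ_w D`** for the trace `t` and determinant `D` of a type-(2) unitary block at an inert place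
(`D · σD = 1`, `σt = t · σD`, `ord_w (t² − 4D) = 2N + 1`); moreover `|y|_w = exp(−N)`.  See the module docstring for the route.
[cite: Rogawski1990, §4.9 Lemma 4.9.3 p. 56] [cite: SerreLocalFields1979, Ch. XIV §4; Ch. V §2] [cite: Neukirch1999, Ch. II (5.7)–(5.8)] -/
theorem exists_skew_sqrt_discriminant {t D : w.1.adicCompletion L}
    (hσD : D * galAdicCompletionMap (L := L) (IsCMField.complexConj L) hw D = 1)
    (hσt : galAdicCompletionMap (L := L) (IsCMField.complexConj L) hw t = t * galAdicCompletionMap (L := L) (IsCMField.complexConj L) hw D)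
    {N : ℕ} (hdisc : Valued.v (t ^ 2 - 4 * D) = WithZero.exp (-((2 * N + 1 : ℕ) : ℤ))) :
    ∃ (y : w.1.adicCompletion L) (k₀ : v.adicCompletion ↥(maximalRealSubfield L)),
      Valued.v k₀ = WithZero.exp (-1 : ℤ) ∧ 4 * D = t * t - y * y * toPlace v w k₀ ∧
        galAdicCompletionMap (L := L) (IsCMField.complexConj L) hw y = -(y * galAdicCompletionMap (L := L) (IsCMField.complexConj L) hw D) ∧
        Valued.v y = WithZero.exp (-(N : ℤ)) := by
  -- in `ℤᵐ⁰`, `x · x = 1 ⇒ x = 1` (the tree's ★ `WithZeroMulInt.eq_one_of_mul_self`, inlined to keep this file's imports local)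
  have h11 : ∀ x : WithZero (Multiplicative ℤ), x * x = 1 → x = 1 := fun x h => by
    have hx0 : x ≠ 0 := fun h0 => by rw [h0, mul_zero] at h; exact zero_ne_one h
    have hlog := congrArg WithZero.log h
    rw [WithZero.log_mul hx0 hx0, WithZero.log_one] at hlog
    rw [← WithZero.exp_log hx0, ← WithZero.exp_zero]
    congr 1
    omega
  set σ := galAdicCompletionMap (L := L) (IsCMField.complexConj L) hw with hσdef
  set ϖF : v.adicCompletion ↥(maximalRealSubfield L) := (HeckeCharacter.uniformizer ↥(maximalRealSubfield L) v : v.adicCompletion ↥(maximalRealSubfield L)) with hϖFdef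
  set ϖ : w.1.adicCompletion L := toPlace v w ϖF with hϖdef
  have hc1 : IsCMField.complexConj L ≠ 1 := IsCMField.complexConj_ne_one L
  have hϖ0 : ϖ ≠ 0 := toPlace_uniformizer_ne_zero L v w hunr
  have hϖF0 : ϖF ≠ 0 := fun h0 => hϖ0 (by rw [hϖdef, h0, map_zero])
  have hσϖ : σ ϖ = ϖ := galAdicCompletionMap_toPlace_self L v w hw _
  have hvϖ : Valued.v ϖ = WithZero.exp (-1 : ℤ) := valued_toPlace_uniformizer L v w hunr
  have hσσ : ∀ x, σ (σ x) = x := galAdicCompletionMap_galAdicCompletionMap_of_smul_eq (IsCMField.complexConj L) w hc1 hw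
  -- `e(w|v) = 1`: `|ι a|_w = |a|_v`
  have he1 : v.asIdeal.ramificationIdx' w.1.asIdeal = 1 := ramificationIdx'_eq_one_of_isUnramifiedIn L v w hunr
  have hιv : ∀ a : v.adicCompletion ↥(maximalRealSubfield L), Valued.v (toPlace v w a) = Valued.v a := valued_toPlace_of_ramificationIdx'_eq_one L v w he1
  have hvϖF : Valued.v ϖF = WithZero.exp (-1 : ℤ) := by rw [← hιv, ← hϖdef, hvϖ]
  -- `D = r²`, `|D| = |r| = 1`, `σD = D⁻¹`
  have hD1 : Valued.v D = 1 := by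
    have h := congrArg Valued.v hσD
    rw [map_mul, hσdef, valued_galAdicCompletionMap, map_one] at h
    exact h11 _ h
  have hD0 : D ≠ 0 := fun h0 => by rw [h0, map_zero] at hD1; exact zero_ne_one hD1
  obtain ⟨r, hr⟩ := isSquare_of_mul_galAdicCompletionMap_eq_one L v w hw hunr h2 hσD
  have hr0 : r ≠ 0 := fun h0 => hD0 (by rw [hr, h0, mul_zero])
  have hvr : Valued.v r = 1 := by
    have h := hD1; rw [hr, map_mul] at h; exact h11 _ h
  -- `Δ₀ := (t² − 4D)·σD` is `σ`-fixed
  have hσΔ₀ : σ ((t ^ 2 - 4 * D) * σ D) = (t ^ 2 - 4 * D) * σ D := by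
    rw [map_mul, map_sub, map_pow, map_mul, map_ofNat, hσσ, hσt]
    linear_combination (t ^ 2 * σ D) * hσD
  obtain ⟨a, ha⟩ := exists_toPlace_eq_of_galAdicCompletionMap_eq (IsCMField.complexConj L) w hc1 hw _ hσΔ₀
  have hvσD : Valued.v (σ D) = 1 := by rw [hσdef, valued_galAdicCompletionMap]; exact hD1
  have hva : Valued.v a = WithZero.exp (-((2 * N + 1 : ℕ) : ℤ)) := by
    rw [← hιv, ha, map_mul, hdisc, hvσD, mul_one]
  -- `r · σr = ±1`, hence `σ r = ∓ (r · σD)` (note `r · σD = r⁻¹`)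
  have hrσD : r * σ D * r = 1 := by
    calc r * σ D * r = (r * r) * σ D := by ring
      _ = D * σ D := by rw [← hr]
      _ = 1 := hσD
  have hNsq : (r * σ r) * (r * σ r) = 1 := by
    calc (r * σ r) * (r * σ r) = (r * r) * σ (r * r) := by rw [map_mul]; ring
      _ = D * σ D := by rw [← hr]
      _ = 1 := hσD
  -- the candidate `y₀ := ϖ^N · r`, `k₀ := a ∕ ϖ_v^{2N}`
  have hk₀v : Valued.v (a / ϖF ^ (2 * N)) = WithZero.exp (-1 : ℤ) := by
    rw [map_div₀, map_pow, hva, hvϖF, ← WithZero.exp_nsmul, ← WithZero.exp_sub, nsmul_eq_mul]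
    congr 1; push_cast; ring
  have hk₀ι : toPlace v w (a / ϖF ^ (2 * N)) * ϖ ^ (2 * N) = (t ^ 2 - 4 * D) * σ D := by
    rw [map_div₀, map_pow, ← hϖdef, ha, div_mul_cancel₀ _ (pow_ne_zero _ hϖ0)]
  have hdisc_eq : 4 * D = t * t - (ϖ ^ N * r) * (ϖ ^ N * r) * toPlace v w (a / ϖF ^ (2 * N)) := by
    have h1 : (ϖ ^ N * r) * (ϖ ^ N * r) * toPlace v w (a / ϖF ^ (2 * N)) = D * (toPlace v w (a / ϖF ^ (2 * N)) * ϖ ^ (2 * N)) := by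
      rw [hr]; ring
    rw [h1, hk₀ι]
    linear_combination (t ^ 2 - 4 * D) * hσD
  have hvy₀ : Valued.v (ϖ ^ N * r) = WithZero.exp (-(N : ℤ)) := by
    rw [map_mul, map_pow, hvϖ, hvr, mul_one, ← WithZero.exp_nsmul, nsmul_eq_mul, mul_neg, mul_one]
  rcases mul_self_eq_one_iff.1 hNsq with hN1 | hN1
  · -- `r σ r = 1`: `σ y₀ = + y₀ σD`; twist by the skew unit `u₁`, `u₁² = ι f₁`
    have hσr : σ r = r * σ D := by
      have h : σ r * r = (r * σ D) * r := by rw [mul_comm, hN1, hrσD]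
      exact mul_right_cancel₀ hr0 h
    obtain ⟨u₁, f₁, hσu₁, hvu₁, hf₁⟩ := exists_skew_unit L v w hw hunr
    have hu₁0 : u₁ ≠ 0 := fun h0 => by rw [h0, map_zero] at hvu₁; exact zero_ne_one hvu₁
    have hf₁0 : toPlace v w f₁ ≠ 0 := by rw [hf₁]; exact mul_ne_zero hu₁0 hu₁0
    have hvf₁ : Valued.v f₁ = 1 := by rw [← hιv, hf₁, map_mul, hvu₁, mul_one]
    refine ⟨ϖ ^ N * r * u₁, a / ϖF ^ (2 * N) / f₁, ?_, ?_, ?_, ?_⟩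
    · rw [map_div₀, hk₀v, hvf₁, div_one]
    · have h1 : toPlace v w (a / ϖF ^ (2 * N) / f₁) = toPlace v w (a / ϖF ^ (2 * N)) / (u₁ * u₁) := by rw [map_div₀, hf₁]
      rw [h1, hdisc_eq]
      field_simp
    · rw [map_mul, map_mul, map_pow, hσϖ, hσr, hσu₁]; ring
    · rw [map_mul, hvy₀, hvu₁, mul_one]
  · -- `r σ r = −1`: `σ y₀ = − y₀ σD`
    have hσr : σ r = -(r * σ D) := by
      have h : σ r * r = -(r * σ D) * r := by rw [mul_comm, hN1, neg_mul, hrσD]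
      exact mul_right_cancel₀ hr0 h
    refine ⟨ϖ ^ N * r, a / ϖF ^ (2 * N), hk₀v, hdisc_eq, ?_, hvy₀⟩
    rw [map_mul, map_pow, hσϖ, hσr]; ring

end CM

end Literature.NumberTheory.LocalFields

end
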